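import Summits.ValiantsHypothesis.ValiantsHypothesis.Theorems.SymPencilSdcPerFourInnerRankNineSquares
import Summits.ValiantsHypothesis.ValiantsHypothesis.Theorems.SymPencilIsotropicKernelSquaresBilinear

/-!
# Route `SymPencil` — cell `(8, 8, 10)` of the size-`27` kernel-package table is EMPTY modulo
# ONE inner-rank hypothesis (`--supports` stmt-ValiantsHypothesis-5674 `SdcSuperquadratic`;
# rung currency only — nothing here bears on `VP ≠ VNP`)

In the base-point package of a symmetric affine determinantal representation of `per_4` of size
`m ≤ 27` over a field of characteristic `0`
(`SymPencilPerFourBasePointPackage.basepoint_package_of_isSymm_isAffineDetRepr_perPoly_four`)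
with an `8`-dimensional space of kernel rows (`r = finrank (im bL) = 8`), the kernel `V = ker bL`
is an `8`-dimensional subspace of `Sing Z(per_4)` — two zero rows or two zero columns
(`SymPencilBoxFourEquality.two_rows_or_two_cols`) — carrying a JOINT family of `10` squares
(`SymPencilIsotropicKernelSquaresBilinear.sum_sq_of_isotropic_defect_bilinear`, defect
`26 - 2·8 = 10`).  In canonical position (rows `0, 1` zero) the `s²`-coefficients of such a
family are a TEN-square identity `Σ_{r<10} c_r t_r((a,b),(y₂,y₃))² = per (a; b; y₂; y₃)` for the
`2 | 2` row split of `per_4`.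

**Theorem** (`false_of_rank_eight_le_twentySeven_of_IR10`): the cell `(8, 8, 10)` is empty GIVEN
the hypothesis **IR10** — «the biquadratic form `per (a; b; y₂; y₃)` is not a weighted sum of TEN
squares of bilinear forms» (inner rank `≥ 11`; `≥ 10` is the tree's
`SymPencilPerFourInnerRankTen.not_exists_joint_nine_squares`, `≤ 12` by the size-`29` pencil),
stated as an explicit Lean hypothesis in the exact shape of `not_exists_joint_nine_squares` with
`Fin 10`.  This PINS the missing lemma of the cell (`Cruxes/SdcSuperquadratic/CELLS-27.md`
§ (8,8,10)) by name and signature; IR10 itself is OPEN (its residue is the kernel-existence lemma at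
ten squares, `INNER-RANK-TEN.md` §«d = 10, 11»).

The transport chain `false_of_joint_rows01_of_IR` → `…_rows_of_IR` → `…_rows_or_cols_of_IR` →
`not_joint_of_IR` is `SymPencilSdcPerFourInnerRankNineSquares` (val-width-5674-p2 g2) with the
nine-square theorem replaced by the hypothesis, for ANY index type `ι` (no cardinality bound), so
the same file closes `(8, 8, d)` from «inner rank `> d`» at every size (with `|ι| ≤ 9` and
`IR := SymPencilPerFourInnerRankTen.false_of_joint_nine_squares hι` it re-derives
`…InnerRankNineSquares.not_joint_nine_squares` term for term; not restated here).

Honest framing: a CONDITIONAL closing of one cell; the cells `(9,7,8)` (modulo H978), `(11,5,4)`,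
`(12,4,2)` and IR10 remain; the window `27 ≤ sdc(per₄) ≤ 29` is UNCHANGED; stmt-5674
`SdcSuperquadratic` stays OPEN; `VP ≠ VNP` is not moved; no summit statement is proved here.
No definitions, no named facts. [folklore]
-/

noncomputable section

-- single-conjunct layout: Sub = Summit, duplicated namespace component intended
set_option linter.dupNamespace false

namespace Summit.ValiantsHypothesis.ValiantsHypothesis.Theorems.SymPencilSdcPerFourCellEightEight

open Matrix MvPolynomial Finset Module
open Literature.Computability.AlgebraicComplexity
open Summit.ValiantsHypothesis.ValiantsHypothesis.Theorems.SymPencilPerFourBlocks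
open Summit.ValiantsHypothesis.ValiantsHypothesis.Theorems.SymPencilPerFourTwoRowsRadical
open Summit.ValiantsHypothesis.ValiantsHypothesis.Theorems.SymPencilBoxFourEquality
open Summit.ValiantsHypothesis.ValiantsHypothesis.Theorems.SymPencilPerFourInnerRankRows
open Summit.ValiantsHypothesis.ValiantsHypothesis.Theorems.SymPencilSdcPerFourInnerRankH88
  (eval_rows01_add_smul_rows23)
open Summit.ValiantsHypothesis.ValiantsHypothesis.Theorems.SymPencilSdcPerFourInnerRankNineSquares
  (joint_family_map)
open Summit.ValiantsHypothesis.ValiantsHypothesis.Theorems.SymPencilIsotropicKernelSquaresBilinear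

variable {K : Type*} [Field K] {ι : Type*} [Fintype ι]

/-! ### The transport chain of `…InnerRankNineSquares`, fed by an inner-rank HYPOTHESIS -/

/-- **Canonical position** (rows `0, 1` zero): a joint family along `V` yields, through its
`s²`-coefficients, a square identity for the `2 | 2` row split, excluded by the hypothesis `IR`.
[folklore] -/
theorem false_of_joint_rows01_of_IR [CharZero K]
    (IR : ∀ (c : ι → K)
      (t : ι → (((Fin 4 → K) × (Fin 4 → K)) →ₗ[K] ((Fin 4 → K) × (Fin 4 → K)) →ₗ[K] K)),
      ¬ ∀ a b y₂ y₃ : Fin 4 → K,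
        ∑ r, c r * (t r (a, b) (y₂, y₃)) ^ 2 = (Matrix.of ![a, b, y₂, y₃]).permanent)
    (V : Submodule K (Fin 4 × Fin 4 → K))
    (h8 : finrank K V = 8) (hV : ∀ x ∈ V, ∀ j, x (0, j) = 0 ∧ x (1, j) = 0) (c : ι → K)
    (β : ι → ((Fin 4 × Fin 4 → K) →ₗ[K] (Fin 4 × Fin 4 → K) →ₗ[K] K))
    (h : ∀ u : Fin 4 × Fin 4 → K, ∀ y ∈ V, ∃ e₀ e₁ : K, ∀ s : K,
      eval (u + s • y) (perPoly (Fin 4) K) = e₀ + s * e₁ + s ^ 2 * ∑ k, c k * (β k u y) ^ 2) :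
    False := by
  -- the two linear embeddings `(a, b) ↦ (a; b; 0; 0)` and `(y₂, y₃) ↦ (0; 0; y₂; y₃)`
  let EU : ((Fin 4 → K) × (Fin 4 → K)) →ₗ[K] (Fin 4 × Fin 4 → K) :=
    { toFun := fun ab p => if p.1 = 0 then ab.1 p.2 else if p.1 = 1 then ab.2 p.2 else 0
      map_add' := fun x y => by
        funext p
        simp only [Prod.fst_add, Prod.snd_add, Pi.add_apply]
        split_ifs <;> simp
      map_smul' := fun s x => by
        funext p
        simp only [Prod.smul_fst, Prod.smul_snd, Pi.smul_apply, smul_eq_mul, RingHom.id_apply]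
        split_ifs <;> simp }
  let EY : ((Fin 4 → K) × (Fin 4 → K)) →ₗ[K] (Fin 4 × Fin 4 → K) :=
    { toFun := fun y p => if p.1 = 2 then y.1 p.2 else if p.1 = 3 then y.2 p.2 else 0
      map_add' := fun x y => by
        funext p
        simp only [Prod.fst_add, Prod.snd_add, Pi.add_apply]
        split_ifs <;> simp
      map_smul' := fun s x => by
        funext p
        simp only [Prod.smul_fst, Prod.smul_snd, Pi.smul_apply, smul_eq_mul, RingHom.id_apply]
        split_ifs <;> simp }
  have hEU : ∀ a b : Fin 4 → K, EU (a, b) =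
      fun p : Fin 4 × Fin 4 => if p.1 = 0 then a p.2 else if p.1 = 1 then b p.2 else 0 :=
    fun a b => rfl
  have hEY : ∀ y₂ y₃ : Fin 4 → K, EY (y₂, y₃) =
      fun p : Fin 4 × Fin 4 => if p.1 = 2 then y₂ p.2 else if p.1 = 3 then y₃ p.2 else 0 :=
    fun y₂ y₃ => rfl
  have hmem : ∀ y₂ y₃ : Fin 4 → K, EY (y₂, y₃) ∈ V := fun y₂ y₃ =>
    mem_of_rows01 V h8 hV _ (fun j => by simp [hEY]) (fun j => by simp [hEY])
  let t : ι → (((Fin 4 → K) × (Fin 4 → K)) →ₗ[K] ((Fin 4 → K) × (Fin 4 → K)) →ₗ[K] K) :=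
    fun r => (β r).compl₁₂ EU EY
  refine IR c t fun a b y₂ y₃ => ?_
  obtain ⟨e₀, e₁, he⟩ := h (EU (a, b)) (EY (y₂, y₃)) (hmem y₂ y₃)
  have P : ∀ s : K, e₀ + s * e₁ + s ^ 2 * ∑ k, c k * (t k (a, b) (y₂, y₃)) ^ 2 =
      s ^ 2 * (Matrix.of ![a, b, y₂, y₃]).permanent := fun s => by
    have hs := he s
    have hev : eval (EU (a, b) + s • EY (y₂, y₃)) (perPoly (Fin 4) K) =
        (Matrix.of ![a, b, s • y₂, s • y₃]).permanent := by
      rw [hEU, hEY]; exact eval_rows01_add_smul_rows23 a b y₂ y₃ s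
    rw [hev, per_smul_row₂, per_smul_row₃] at hs
    rw [show ∑ k, c k * (t k (a, b) (y₂, y₃)) ^ 2 = ∑ k, c k * (β k (EU (a, b)) (EY (y₂, y₃))) ^ 2
      from rfl, ← hs]
    ring
  have h0 := P 0
  have h1 := P 1
  have h1' := P (-1)
  have h2 : (2 : K) * ∑ k, c k * (t k (a, b) (y₂, y₃)) ^ 2 =
      2 * (Matrix.of ![a, b, y₂, y₃]).permanent := by
    linear_combination h1 + h1' - 2 * h0
  exact (mul_right_inj' two_ne_zero).1 h2

/-- **Two prescribed zero rows**, fed by `IR`. [folklore] -/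
theorem false_of_joint_rows_of_IR [CharZero K]
    (IR : ∀ (c : ι → K)
      (t : ι → (((Fin 4 → K) × (Fin 4 → K)) →ₗ[K] ((Fin 4 → K) × (Fin 4 → K)) →ₗ[K] K)),
      ¬ ∀ a b y₂ y₃ : Fin 4 → K,
        ∑ r, c r * (t r (a, b) (y₂, y₃)) ^ 2 = (Matrix.of ![a, b, y₂, y₃]).permanent)
    (V : Submodule K (Fin 4 × Fin 4 → K))
    (h8 : finrank K V = 8) {p q : Fin 4} (hpq : p ≠ q)
    (hV : ∀ x ∈ V, ∀ j, x (p, j) = 0 ∧ x (q, j) = 0) (c : ι → K)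
    (β : ι → ((Fin 4 × Fin 4 → K) →ₗ[K] (Fin 4 × Fin 4 → K) →ₗ[K] K))
    (h : ∀ u : Fin 4 × Fin 4 → K, ∀ y ∈ V, ∃ e₀ e₁ : K, ∀ s : K,
      eval (u + s • y) (perPoly (Fin 4) K) = e₀ + s * e₁ + s ^ 2 * ∑ k, c k * (β k u y) ^ 2) :
    False := by
  obtain ⟨σ, hσ0, hσ1⟩ := exists_perm_zero_one p q hpq
  set e := Equiv.prodCongr σ (1 : Equiv.Perm (Fin 4)) with he
  set Φ : (Fin 4 × Fin 4 → K) ≃ₗ[K] (Fin 4 × Fin 4 → K) := LinearEquiv.funCongrLeft K K e with hΦ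
  have hΦa : ∀ (x : Fin 4 × Fin 4 → K) (i j : Fin 4), Φ x (i, j) = x (σ i, j) := fun x i j => by
    simp [hΦ, he]
  have hΦper : ∀ z, eval (Φ z) (perPoly (Fin 4) K) = eval z (perPoly (Fin 4) K) := fun z => by
    have : (Φ z : Fin 4 × Fin 4 → K) = z ∘ e := rfl
    rw [this, he, eval_perPoly_comp_prodCongr]
  have h' := joint_family_map V Φ hΦper c β h
  set V' := V.map Φ.toLinearMap with hV'def
  have h8' : finrank K V' = 8 := by rw [hV'def, LinearEquiv.finrank_map_eq, h8]
  have hV' : ∀ y ∈ V', ∀ j, y (0, j) = 0 ∧ y (1, j) = 0 := by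
    rintro _ ⟨x, hx, rfl⟩ j
    rw [LinearEquiv.coe_toLinearMap, hΦa, hΦa, hσ0, hσ1]
    exact hV x hx j
  exact false_of_joint_rows01_of_IR IR V' h8' hV' c _ h'

/-- **Two prescribed zero rows or columns**, fed by `IR`. [folklore] -/
theorem false_of_joint_rows_or_cols_of_IR [CharZero K]
    (IR : ∀ (c : ι → K)
      (t : ι → (((Fin 4 → K) × (Fin 4 → K)) →ₗ[K] ((Fin 4 → K) × (Fin 4 → K)) →ₗ[K] K)),
      ¬ ∀ a b y₂ y₃ : Fin 4 → K,
        ∑ r, c r * (t r (a, b) (y₂, y₃)) ^ 2 = (Matrix.of ![a, b, y₂, y₃]).permanent)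
    (V : Submodule K (Fin 4 × Fin 4 → K))
    (h8 : finrank K V = 8)
    (hV : (∃ p q : Fin 4, p ≠ q ∧ ∀ x ∈ V, ∀ j, x (p, j) = 0 ∧ x (q, j) = 0) ∨
      (∃ p q : Fin 4, p ≠ q ∧ ∀ x ∈ V, ∀ i, x (i, p) = 0 ∧ x (i, q) = 0)) (c : ι → K)
    (β : ι → ((Fin 4 × Fin 4 → K) →ₗ[K] (Fin 4 × Fin 4 → K) →ₗ[K] K))
    (h : ∀ u : Fin 4 × Fin 4 → K, ∀ y ∈ V, ∃ e₀ e₁ : K, ∀ s : K,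
      eval (u + s • y) (perPoly (Fin 4) K) = e₀ + s * e₁ + s ^ 2 * ∑ k, c k * (β k u y) ^ 2) :
    False := by
  rcases hV with ⟨p, q, hpq, hV⟩ | ⟨p, q, hpq, hV⟩
  · exact false_of_joint_rows_of_IR IR V h8 hpq hV c β h
  · -- transpose, then the row case
    set Φ : (Fin 4 × Fin 4 → K) ≃ₗ[K] (Fin 4 × Fin 4 → K) :=
      LinearEquiv.funCongrLeft K K (Equiv.prodComm (Fin 4) (Fin 4)) with hΦ
    have hΦa : ∀ (x : Fin 4 × Fin 4 → K) (i j : Fin 4), Φ x (i, j) = x (j, i) := fun x i j => rfl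
    have h' := joint_family_map V Φ eval_perPoly_transpose c β h
    set V' := V.map Φ.toLinearMap with hV'def
    have h8' : finrank K V' = 8 := by rw [hV'def, LinearEquiv.finrank_map_eq, h8]
    have hV' : ∀ y ∈ V', ∀ j, y (p, j) = 0 ∧ y (q, j) = 0 := by
      rintro _ ⟨x, hx, rfl⟩ j
      rw [LinearEquiv.coe_toLinearMap, hΦa, hΦa]
      exact hV x hx j
    exact false_of_joint_rows_of_IR IR V' h8' hpq hV' c _ h'

/-- **No `8`-dimensional singular subspace carries a joint family indexed by `ι`, GIVEN the
inner-rank hypothesis `IR` at `ι`** (characteristic `0`; BoxFour equality puts `V` on two rows or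
two columns).  With `ι`, `|ι| ≤ 9` and `IR := false_of_joint_nine_squares` this is
`…InnerRankNineSquares.not_joint_nine_squares`. [folklore] -/
theorem not_joint_of_IR [CharZero K]
    (IR : ∀ (c : ι → K)
      (t : ι → (((Fin 4 → K) × (Fin 4 → K)) →ₗ[K] ((Fin 4 → K) × (Fin 4 → K)) →ₗ[K] K)),
      ¬ ∀ a b y₂ y₃ : Fin 4 → K,
        ∑ r, c r * (t r (a, b) (y₂, y₃)) ^ 2 = (Matrix.of ![a, b, y₂, y₃]).permanent) :
    ∀ V : Submodule K (Fin 4 × Fin 4 → K),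
      (∀ x ∈ V, ∀ (r c : Fin 3 → Fin 4), Function.Injective r → Function.Injective c →
        ((Matrix.of fun i j => x (i, j)).submatrix r c).permanent = 0) →
      finrank K V = 8 → ∀ (c : ι → K)
        (β : ι → ((Fin 4 × Fin 4 → K) →ₗ[K] (Fin 4 × Fin 4 → K) →ₗ[K] K)),
      ¬ (∀ u : Fin 4 × Fin 4 → K, ∀ y ∈ V, ∃ e₀ e₁ : K, ∀ s : K,
          eval (u + s • y) (perPoly (Fin 4) K) = e₀ + s * e₁ + s ^ 2 * ∑ k, c k * (β k u y) ^ 2) :=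
  fun V hV h8 c β h => false_of_joint_rows_or_cols_of_IR IR V h8 (two_rows_or_two_cols V hV h8) c β h

/-! ### The cell `(8, 8, 10)` modulo IR10 -/

/-- **Cell `(8, 8, 10)` is empty modulo IR10.**  In the base-point package of a symmetric affine
determinantal representation of `per_4` of size `m ≤ 27` with `finrank (im bL) = 8`, the kernel is
an `8`-dimensional singular subspace carrying a joint `10`-square family
(`sum_sq_of_isotropic_defect_bilinear`, `26 ≤ 2·8 + 10`), excluded by `not_joint_of_IR` as soon as
**IR10** — no ten-square identity `Σ_{r<10} c_r t_r((a,b),(y₂,y₃))² = per (a; b; y₂; y₃)` — holds.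
IR10 is OPEN (inner rank `≥ 11`; the tree has `≥ 10`). [folklore] -/
theorem false_of_rank_eight_le_twentySeven_of_IR10 (K : Type*) [Field K] [CharZero K]
    {m : ℕ} (hm : m ≤ 27)
    {i₀ : Fin m} {D : Matrix {i // i ≠ i₀} {i // i ≠ i₀} K}
    {bL : (Fin 4 × Fin 4 → K) →ₗ[K] ({i // i ≠ i₀} → K)}
    {CL : (Fin 4 × Fin 4 → K) →ₗ[K] Matrix {i // i ≠ i₀} {i // i ≠ i₀} K} {κ : K}
    (hD : IsUnit D.det) (hDs : Dᵀ = D) (hCs : ∀ z, (CL z)ᵀ = CL z) (hκ : κ ≠ 0)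
    (hi : ∀ z, bL z ⬝ᵥ D⁻¹ *ᵥ bL z = 0)
    (hii : ∀ z, bL z ⬝ᵥ (D⁻¹ * CL z * D⁻¹) *ᵥ bL z = 0)
    (hiii : ∀ z, D.det * (bL z ⬝ᵥ (D⁻¹ * CL z * D⁻¹ * CL z * D⁻¹) *ᵥ bL z) =
      -(κ * eval z (perPoly (Fin 4) K)))
    (hV4 : ∀ x ∈ LinearMap.ker bL, ∀ r c : Fin 4,
      ((Matrix.of fun i j => x (i, j)).submatrix r.succAbove c.succAbove).permanent = 0)
    (hcard : Fintype.card {i // i ≠ i₀} + 1 = m)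
    (hrn : finrank K (LinearMap.range bL) + finrank K (LinearMap.ker bL) = 16)
    (IR10 : ∀ (c : Fin 10 → K)
      (t : Fin 10 → (((Fin 4 → K) × (Fin 4 → K)) →ₗ[K] ((Fin 4 → K) × (Fin 4 → K)) →ₗ[K] K)),
      ¬ ∀ a b y₂ y₃ : Fin 4 → K,
        ∑ r, c r * (t r (a, b) (y₂, y₃)) ^ 2 = (Matrix.of ![a, b, y₂, y₃]).permanent)
    (h8 : finrank K (LinearMap.range bL) = 8) : False := by
  classical
  have hk8 : finrank K (LinearMap.ker bL) = 8 := by omega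
  -- the joint family of `10` squares along the kernel (`|ι'| = m - 1 ≤ 26 = 2·8 + 10`)
  obtain ⟨c, β, hcβ⟩ := sum_sq_of_isotropic_defect_bilinear hD hDs bL CL hCs
    (fun z => eval z (perPoly (Fin 4) K)) hκ hi hii hiii 10 (by omega)
  set V := LinearMap.ker bL with hVdef
  have hfam : ∀ u : Fin 4 × Fin 4 → K, ∀ y ∈ V, ∃ e₀ e₁ : K, ∀ s : K,
      eval (u + s • y) (perPoly (Fin 4) K) = e₀ + s * e₁ + s ^ 2 * ∑ k, c k * (β k u y) ^ 2 :=
    fun u y hy => hcβ u y (LinearMap.mem_ker.1 hy)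
  have hV3 : ∀ x ∈ V, ∀ (r c : Fin 3 → Fin 4), Function.Injective r → Function.Injective c →
      ((Matrix.of fun i j => x (i, j)).submatrix r c).permanent = 0 :=
    fun x hx r c hr hc => subperm_vanish_inj_of_succAbove x (hV4 x hx) r c hr hc
  exact not_joint_of_IR IR10 V hV3 hk8 c β hfam

/-- **The same one size up**: cell `(8, 8, 11)` of `m = 28` is empty modulo **IR11** (no
ELEVEN-square identity; `27 ≤ 2·8 + 11`). [folklore] -/
theorem false_of_rank_eight_le_twentyEight_of_IR11 (K : Type*) [Field K] [CharZero K]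
    {m : ℕ} (hm : m ≤ 28)
    {i₀ : Fin m} {D : Matrix {i // i ≠ i₀} {i // i ≠ i₀} K}
    {bL : (Fin 4 × Fin 4 → K) →ₗ[K] ({i // i ≠ i₀} → K)}
    {CL : (Fin 4 × Fin 4 → K) →ₗ[K] Matrix {i // i ≠ i₀} {i // i ≠ i₀} K} {κ : K}
    (hD : IsUnit D.det) (hDs : Dᵀ = D) (hCs : ∀ z, (CL z)ᵀ = CL z) (hκ : κ ≠ 0)
    (hi : ∀ z, bL z ⬝ᵥ D⁻¹ *ᵥ bL z = 0)
    (hii : ∀ z, bL z ⬝ᵥ (D⁻¹ * CL z * D⁻¹) *ᵥ bL z = 0)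
    (hiii : ∀ z, D.det * (bL z ⬝ᵥ (D⁻¹ * CL z * D⁻¹ * CL z * D⁻¹) *ᵥ bL z) =
      -(κ * eval z (perPoly (Fin 4) K)))
    (hV4 : ∀ x ∈ LinearMap.ker bL, ∀ r c : Fin 4,
      ((Matrix.of fun i j => x (i, j)).submatrix r.succAbove c.succAbove).permanent = 0)
    (hcard : Fintype.card {i // i ≠ i₀} + 1 = m)
    (hrn : finrank K (LinearMap.range bL) + finrank K (LinearMap.ker bL) = 16)
    (IR11 : ∀ (c : Fin 11 → K)
      (t : Fin 11 → (((Fin 4 → K) × (Fin 4 → K)) →ₗ[K] ((Fin 4 → K) × (Fin 4 → K)) →ₗ[K] K)),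
      ¬ ∀ a b y₂ y₃ : Fin 4 → K,
        ∑ r, c r * (t r (a, b) (y₂, y₃)) ^ 2 = (Matrix.of ![a, b, y₂, y₃]).permanent)
    (h8 : finrank K (LinearMap.range bL) = 8) : False := by
  classical
  have hk8 : finrank K (LinearMap.ker bL) = 8 := by omega
  obtain ⟨c, β, hcβ⟩ := sum_sq_of_isotropic_defect_bilinear hD hDs bL CL hCs
    (fun z => eval z (perPoly (Fin 4) K)) hκ hi hii hiii 11 (by omega)
  set V := LinearMap.ker bL with hVdef
  have hfam : ∀ u : Fin 4 × Fin 4 → K, ∀ y ∈ V, ∃ e₀ e₁ : K, ∀ s : K,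
      eval (u + s • y) (perPoly (Fin 4) K) = e₀ + s * e₁ + s ^ 2 * ∑ k, c k * (β k u y) ^ 2 :=
    fun u y hy => hcβ u y (LinearMap.mem_ker.1 hy)
  have hV3 : ∀ x ∈ V, ∀ (r c : Fin 3 → Fin 4), Function.Injective r → Function.Injective c →
      ((Matrix.of fun i j => x (i, j)).submatrix r c).permanent = 0 :=
    fun x hx r c hr hc => subperm_vanish_inj_of_succAbove x (hV4 x hx) r c hr hc
  exact not_joint_of_IR IR11 V hV3 hk8 c β hfam

end Summit.ValiantsHypothesis.ValiantsHypothesis.Theorems.SymPencilSdcPerFourCellEightEight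

end
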